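import Summits.QuantumFields.BalabanUV.Beta.HessKerDressedUnitsWall

/-!
# Beta / PropagatorWoodburyFibreTarget — the G-an2-4 ∕ (CONV-C) RESOLVENT TARGET, stated (Lean statement first), and its plug
into the wall's END by name

Cell `pub-balaban`, β sub-cell, BINDER ROW **G-an2-4 ∕ (CONV-C)** (prover part P3 = Woodbury fibre, unit `b2b-balaban-gan24-p3`).
HONEST FRAMING (verbatim): discharging `BetaPertH` makes Bałaban's UV stability UNCONDITIONAL — a real constructive-QFT result; it is
NOT the continuum limit and NOT the Clay problem.  HONEST DEPENDENCY: continuum YM on T⁴ ⇐ BetaPertH ∧ nine spine estimates (0/9 proved);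
BetaPertH ⇐ (D1) ∧ (D4) ∧ CAP+tail; G-an2-4 gates asym, D1 and NE2/3/4.

WHAT THIS FILE DOES.  It TYPES — and does NOT prove — the resolvent part of the located open input O-asym1-1 = G-an2-4 in its final
consumer shape: the two binders `hK` (scale-UNIFORM pointwise exponential decay) and `hKall` (ALL-SCALES deviations with geometric rate,
King's (4.38) shape [cite: King1986, Lemma 4.5 (4.38) p.674] — locator of the printed SHAPE for King's scalar covariance; nothing printed
is used) of `HessKerDressedUnitsWall.d1Drift_JsBalOf_iff_of_cauchy_unit` AT THE NAMED INSTANCE `(s_f j, s_m j) = (Lc^j, Lc^{j(d+1)})`,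
`d + 1 = 4` (journal Q-asym1-8, adopted), for the decimated composite one-step resolvents `KInvStep Lc j` of Bałaban's `U = 1`
block-averaging KKT system — as ONE named `Prop`, `ConvCResolvent Lc C δK cK θ`, with every constant explicit and depending on nothing
hidden (`C, δK` = uniform amplitude/decay; `cK, θ` = rate data; the wall needs in addition `0 ≤ θ < 1` and `0 < R < δK`, kept as
separate binders exactly as the END has them).  `d1Drift_iff_of_convCResolvent` is the END with `hK`/`hKall` supplied from the `Prop`
(pure plug, no mathematics), so that a supplier of `ConvCResolvent` closes the resolvent third of O-asym1-1 BY NAME; the stencil (`hS`,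
`hSall`) and table (`hW`, `hWall`) thirds stay explicit binders (rows D1 ∕ an2, an4).

STATUS: `ConvCResolvent` is OPEN — NOT IN PRINT (Bałaban prints `k`-uniform BOUNDS for his propagators, never scale-to-scale rates;
GAPS G-an2-4, AN2.md §9) and NOT PROVED here.  The Woodbury-fibre route to it (sibling `PropagatorWoodburyFibre`): per Bloch fibre the
blocks of `KInvStep Lc j` are, by the composition law `decimate_kktBlocks_comp`, the one-step blocks over the step-`j` effective form, whose
`U = 1` rate is the scalar-alias-sum rate of the tree (`B5ActionRate166.w166_rate`, `T4Rate166StripDirect.W166_rate`; King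
`EffectiveLaplacianRate.abs_effSymbol_sub_le` on each scalar fibre) — CONDITIONAL on the factorisation of the composite gauge rows through
`Q_j` (located, `HOME/b2b-balaban-gan24-p3/WOODBURY-FIBRE.md`).  Nothing of (I2-b), (D1), (D4), CAP is touched.
-/

noncomputable section

open Finset
open scoped BigOperators
open Literature.MathematicalPhysics.QuantumFieldTheory.Balaban1983to89
open Literature.MathematicalPhysics.QuantumFieldTheory.Balaban1983to89.Beta
open ExpKernelCalculus (MKer Decays VertexFamily₂ hessKer)
open OneStepResolventKernel (Fib LocStencil)
open OneStepKernelFamily (KInvStep D1Drift)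
open AxialDressing (axDressK axVertexOfK)
open BalabanStepJetsSucc (JsBal0Of JsBalOf)
open HessKerDressedLimit (limMKerOf limStOf limTabOf)
open Summit.QuantumFields.BalabanUV.Beta.HessKerDressedUnits
open Summit.QuantumFields.BalabanUV.Beta.HessKerDressedUnitsWall

namespace Summit.QuantumFields.BalabanUV.Beta.PropagatorWoodburyFibreTarget

/-- The one-step-normalised FIELD-leg unit at step `j`: `s_f j = Lc^j` (journal Q-asym1-8, an4's half, adopted by asym1). [folklore] -/
def sfStep (Lc j : ℕ) : ℝ := (Lc : ℝ) ^ j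

/-- The one-step-normalised MULTIPLIER-leg unit at step `j`: `s_m j = Lc^{j(d+1)}`, `d + 1 = 4`. [folklore] -/
def smStep (Lc j : ℕ) : ℝ := (Lc : ℝ) ^ (j * (3 + 1))

/-- `s_f j ≠ 0` for `Lc ≥ 1`. [folklore] -/
theorem sfStep_ne_zero {Lc : ℕ} (hLc : 1 ≤ Lc) (j : ℕ) : sfStep Lc j ≠ 0 :=
  pow_ne_zero _ (Nat.cast_ne_zero.mpr (by omega))

/-- `s_m j ≠ 0` for `Lc ≥ 1`. [folklore] -/
theorem smStep_ne_zero {Lc : ℕ} (hLc : 1 ≤ Lc) (j : ℕ) : smStep Lc j ≠ 0 :=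
  pow_ne_zero _ (Nat.cast_ne_zero.mpr (by omega))

/-- The step-`j` resolvent primitive IN ONE-STEP UNITS: `K_j^{(1)} := D_j (KInvStep Lc j) D_j`, `D_j = diag(Lc^j ∣ Lc^{4j})`. [folklore] -/
def unitResolvent (Lc : ℕ) [NeZero Lc] (j : ℕ) : MKer (3 + 1) (Fib 3) :=
  unitK (sfStep Lc j) (smStep Lc j) (KInvStep (d := 3) Lc j)

/-- **THE G-an2-4 ∕ (CONV-C) RESOLVENT TARGET** (O-asym1-1, resolvent third, final consumer shape; OPEN, NOT IN PRINT, NOT PROVED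
HERE): scale-UNIFORM pointwise exponential decay of the one-step-normalised resolvents `K_j^{(1)}` with constants `(C, δK)`, AND
all-scales deviations `|K_{k+j}^{(1)} − K_k^{(1)}| ≤ cK·θ^k·e^{−δK|x−y|₁}` entrywise (King's (4.38) shape).  The constants are the
arguments; nothing is hidden in an existential. [folklore] -/
def ConvCResolvent (Lc : ℕ) [NeZero Lc] (C δK cK θ : ℝ) : Prop :=
  (∀ j, Decays (unitResolvent Lc j) C δK) ∧
    ∀ k j, Decays (unitResolvent Lc (k + j) - unitResolvent Lc k) (cK * θ ^ k) δK

/-- The uniform-decay half `hK`. [folklore] -/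
theorem ConvCResolvent.hK {Lc : ℕ} [NeZero Lc] {C δK cK θ : ℝ} (h : ConvCResolvent Lc C δK cK θ) (j : ℕ) :
    Decays (unitK (sfStep Lc j) (smStep Lc j) (KInvStep (d := 3) Lc j)) C δK :=
  h.1 j

/-- The all-scales-deviation half `hKall`. [folklore] -/
theorem ConvCResolvent.hKall {Lc : ℕ} [NeZero Lc] {C δK cK θ : ℝ} (h : ConvCResolvent Lc C δK cK θ) (k j : ℕ) :
    Decays (unitK (sfStep Lc (k + j)) (smStep Lc (k + j)) (KInvStep (d := 3) Lc (k + j)) -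
      unitK (sfStep Lc k) (smStep Lc k) (KInvStep (d := 3) Lc k)) (cK * θ ^ k) δK :=
  h.2 k j

section Plug

variable {Lc : ℕ} [NeZero Lc] (hLc : 1 ≤ Lc) (cE cVH cΛ : ℝ)
  (W : ℕ → Fin (3 + 1) → (Fin (3 + 1) → ℤ) → Fin (3 + 1) → (Fin (3 + 1) → ℤ) → MKer (3 + 1) (Fib 3))
  (Cw' δw : ℕ → ℝ) (hδw : ∀ j, 0 < δw j) (hW' : ∀ j, VertexFamily₂ (W j) Lc (Cw' j) (δw j))
  {R C cK δK Cs cS δS Cw cW δW θ : ℝ}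

/-- **THE WALL'S END WITH THE RESOLVENT THIRD SUPPLIED BY NAME**: `ConvCResolvent Lc C δK cK θ` discharges the binders `hK`, `hKall` of
`HessKerDressedUnitsWall.d1Drift_JsBalOf_iff_of_cauchy_unit` at the instance `(s_f, s_m) = (Lc^j, Lc^{4j})`; the stencil and table
binders, the rate window `0 ≤ θ < 1` and the decay window `0 < R < δK, R/2 < δS, R < δW` stay explicit.  Pure plug. [folklore] -/
theorem d1Drift_iff_of_convCResolvent (hconv : ConvCResolvent Lc C δK cK θ)
    (hS : ∀ j, LocStencil (unitS (sfStep Lc j) (smStep Lc j) (JsBal0Of hLc cE cVH cΛ W Cw' δw hδw hW' j).S) Cs δS)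
    (hSall : ∀ k j, LocStencil (unitS (sfStep Lc (k + j)) (smStep Lc (k + j)) (JsBal0Of hLc cE cVH cΛ W Cw' δw hδw hW' (k + j)).S -
      unitS (sfStep Lc k) (smStep Lc k) (JsBal0Of hLc cE cVH cΛ W Cw' δw hδw hW' k).S) (cS * θ ^ k) δS)
    (hW : ∀ j, VertexFamily₂ (unitW (sfStep Lc j) (smStep Lc j) (W j)) Lc Cw δW)
    (hWall : ∀ k j, VertexFamily₂ (unitW (sfStep Lc (k + j)) (smStep Lc (k + j)) (W (k + j)) -
      unitW (sfStep Lc k) (smStep Lc k) (W k)) Lc (cW * θ ^ k) δW)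
    (hR : 0 < R) (hRK : R < δK) (hRS : R / 2 < δS) (hRW : R < δW) (hθ0 : 0 ≤ θ) (hθ1 : θ < 1) (μ ν : Fin 4) (N : ℝ) :
    D1Drift Lc (JsBalOf hLc cE cVH cΛ W Cw' δw hδw hW') N μ ν ↔
      B12Beta.secondMoment (hessKer (axDressK Lc (limMKerOf fun j => unitK (sfStep Lc j) (smStep Lc j) (KInvStep (d := 3) Lc j)))
        (axVertexOfK (limMKerOf fun j => unitK (sfStep Lc j) (smStep Lc j) (KInvStep (d := 3) Lc j)) Lc
          (limStOf fun j => unitS (sfStep Lc j) (smStep Lc j) (JsBal0Of hLc cE cVH cΛ W Cw' δw hδw hW' j).S))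
        (limTabOf fun j => unitW (sfStep Lc j) (smStep Lc j) (W j))) μ ν = B12Normalization.stepBal N Lc :=
  d1Drift_JsBalOf_iff_of_cauchy_unit hLc cE cVH cΛ W Cw' δw hδw hW' (sfStep Lc) (smStep Lc) (sfStep_ne_zero hLc)
    (smStep_ne_zero hLc) hconv.hK hconv.hKall hS hSall hW hWall hR hRK hRS hRW hθ0 hθ1 μ ν N

end Plug

end Summit.QuantumFields.BalabanUV.Beta.PropagatorWoodburyFibreTarget

end
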